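import Summits.RiemannHypothesis.RiemannHypothesis.Theorems.WeilFormatCDataLog3HalfTables
import Summits.RiemannHypothesis.RiemannHypothesis.Theorems.WeilFormatCDataLog3HalfTabValid
import HarnessLib

/-!
# Format C kernel rung `Log3Half` (a = (log 3)/2): light-table slices [(24, 27), (51, 27), (78, 27), (105, 26)] (kernel certificates) and the validity of the light table

Window `a = (log 3)/2`; prime powers in the window: 2; evaluator parameters S = 2^80, Kpi 70, Kser 96, kred 8, Kexp 24, J 60; full table modes < 34; light column table modes < 131; units 2^-80 (entries), 2^-40 (weights).
Generated by rh-explicit-weil-2 gen5 (gen/gramgen.py + emit5.py) from `#eval` of the tree's `Encl` functions; every datum is re-verified by the kernel in the theorem files (`decide +kernel`: recompute + containment). Helper data of the rh-explicit Weil-positivity programme (format C, K-CELL-2 CAL rung), RH-free. [cite: Yoshida1992HermitianForms, §5 (5.15)-(5.16) p. 301; §7 pp. 305–312]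
-/

set_option linter.dupNamespace false
set_option maxRecDepth 200000

namespace Summit.RiemannHypothesis.RiemannHypothesis.Theorems.WeilFormatCData.Log3Half
open Literature.NumberTheory.LFunctions Literature.NumberTheory.LFunctions.Yoshida1992 Encl Literature.Analysis.ValidatedNumerics.NumericsMP

/-- kernel: light-table slice `[24, 51)`. -/
theorem tC24 : checkTableCol prm C ctab 24 27 = true := by decide +kernel

/-- kernel: light-table slice `[51, 78)`. -/
theorem tC51 : checkTableCol prm C ctab 51 27 = true := by decide +kernel

/-- kernel: light-table slice `[78, 105)`. -/
theorem tC78 : checkTableCol prm C ctab 78 27 = true := by decide +kernel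

/-- kernel: light-table slice `[105, 131)`. -/
theorem tC105 : checkTableCol prm C ctab 105 26 = true := by decide +kernel

/-- the light column table is valid on `[24, 131)`. -/
theorem ctab_valid : TabColValid (2 ^ 80) a ks 24 131 ctab := by
  have h24 : TabColValid (2 ^ 80) a ks 24 24 ctab := TabColValid.empty
  have h51 : TabColValid (2 ^ 80) a ks 24 (24 + 27) ctab :=
    h24.extend fun m hm hmk ↦ colValid_of_checkTableCol (prm := prm) (by norm_num [prm]) a_pos consts_valid tC24 hm hmk
  have h78 : TabColValid (2 ^ 80) a ks 24 (51 + 27) ctab :=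
    h51.extend fun m hm hmk ↦ colValid_of_checkTableCol (prm := prm) (by norm_num [prm]) a_pos consts_valid tC51 hm hmk
  have h105 : TabColValid (2 ^ 80) a ks 24 (78 + 27) ctab :=
    h78.extend fun m hm hmk ↦ colValid_of_checkTableCol (prm := prm) (by norm_num [prm]) a_pos consts_valid tC78 hm hmk
  have h131 : TabColValid (2 ^ 80) a ks 24 (105 + 26) ctab :=
    h105.extend fun m hm hmk ↦ colValid_of_checkTableCol (prm := prm) (by norm_num [prm]) a_pos consts_valid tC105 hm hmk
  exact h131

/-- even column range. -/
theorem ctab_valid_even : TabColValid (2 ^ 80) a ks 25 (64 + 1) ctab :=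
  fun m hm hmk ↦ ctab_valid m (by omega) (by omega)

/-- odd column range. -/
theorem ctab_valid_odd : TabColValid (2 ^ 80) a ks 24 (64 + 2) ctab :=
  fun m hm hmk ↦ ctab_valid m (by omega) (by omega)

/-- odd column range (rows form). -/
theorem ctab_valid_odd1 : TabColValid (2 ^ 80) a ks 24 (64 + 1) ctab :=
  fun m hm hmk ↦ ctab_valid m (by omega) (by omega)

end Summit.RiemannHypothesis.RiemannHypothesis.Theorems.WeilFormatCData.Log3Half
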